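import Mathlib
import HarnessLib
import HarnessLib.Audit
import Summits.NavierStokesRegularity.Statement
import Literature.Analysis.FluidPDE.ClassicalSolution
import Literature.Analysis.FluidPDE.LerayHopf
import Literature.Analysis.FluidPDE.AxisymmetricEuler
import Literature.Analysis.FluidPDE.SelfSimilarLiouville
import Literature.Analysis.FluidPDE.NSWave0

/-!
Route: KnvAxisInflow

CLOSED (retired) 2026-08-15T13:49:08Z by operator:999:1257524 — reason: not-a-thesis: assembly does not conclude the sub-problem Statement — note: D-0027 §2.1 audit (human 2026-08-15: routes that do not decide the summit are removed): the assembly concludes `Literature.Analysis.FluidPDE.AxisymmetricSwirlRegularity`, not the sub-problem statement; a NEW conforming route may be opened from the same idea (generated `closes : … → _root_.NavierStok. The file is kept as the record of this route; refuted decls are indexed as negative knowledge (`ledger negatives`).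

# Route KnvAxisInflow — NavierStokesRegularity, positive side, AXISYMMETRIC INTERMEDIATE THESIS
(PROBLEMS.md §3); realises idea card knv-axis-inflow-law ("KNV at the axis: propagate Lei–Zhang's
log⁻² modulus of the swirl by a two-point maximum principle; a breakthrough needs radial inflow with
r|u_r| ≥ 2ν")

## Target and its place under the summit
TARGET X = NoBlowupAxisym (shared verbatim with route SwirlSignGeometry,
stmt-NavierStokesRegularity-1134): every classical solution of unforced NS on ℝ³×[0,T) that is
Leray–Hopf on [0,T), bounded on every sub-slab [0,T']×ℝ³ (T'<T), with axisymmetric slices and a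
rapidly decaying datum, extends classically past T. The Assembly ends in the wall AX =
`Literature.Analysis.FluidPDE.AxisymmetricSwirlRegularity` (ns.S25) through the shared glue X → AX
(stmt-…-1139). AX ↛ Clay (A) and this route does not pretend otherwise (an item 'AX → A' would be
Clay (A) in disguise); AX's summit-side use is the PROVED kill edge
`Literature.NS.certifiedBlowup_kill_edge` (stmt-…-0729: AX → X5b → ¬X5a_axi) against the
axisymmetric blow-up thesis of route CertifiedBlowup, and AX is the §3 intermediate thesis every
positive route must pass.
Lean (elaborates; planner Sketch.lean rc 0):
 X: ∀ ν T, 0<ν → 0<T → ∀ u p, IsClassicalNSSolutionOn (Ico 0 T) ν 0 u p → IsLerayHopfOn T ν 0 (u 0)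
u → (∀ T'<T, ∃ M, ∀ t ∈ Icc 0 T', ∀ x, ‖u t x‖ ≤ M) → (∀ t ∈ Ico 0 T, IsAxisymmetric (u t)) →
HasRapidSpatialDecay (u 0) → HasSmoothExtensionPast ν 0 u T

## "It suffices to show" — the inflow law
Write Γ = swirl = x₀u₁ − x₁u₀ = r u_θ (in-tree, junk-free), r = cylRadius, and r·u_r = x₀u₀ + x₁u₁
(junk-free radial momentum). Γ solves ∂_tΓ + b·∇Γ = ν(Δ − (2/r)∂_r)Γ (in-tree
swirl_transport_holds), |Γ| ≤ ‖Γ₀‖_∞, Γ = 0 on the axis, and the sharpest known regularity criteria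
ARE moduli of continuity of Γ at the axis: |Γ| ≤ C|ln r|⁻² near the axis ⇒ regular (LeiZhang2017 Cor
1.3, ANY C; Wei2016 Cor 1.1 |ln r|^{-3/2}; ChenFangZhang2017 r^α). NEW ELEMENTARY COMPUTATION
(planner, checked twice): for m(r) = A/ln²(l/r), L = ln(l/r) ≥ 3, one has r m''/m' = 3/L − 1, so m
is a supersolution of the swirl equation at a point iff r u_r ≥ −(2 − 3/L)ν there. Hence at a first
touching point of |Γ| with m (interior, 0<r<δ≤l e⁻³) BREAKTHROUGH NEEDS RADIAL INFLOW WITH r|u_r| >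
(2 − 3/ln(l/r))ν: outflow never breaks the modulus, inflow must have local Reynolds number ≥ 2 (the
'2' is the critical drift turning ∂_rr − (1/r)∂_r into the 2-D Laplacian; power moduli r^α give 2 −
α, the bare u_θ maximum principle gives 1). So X follows from: (AxisCriterion, shared stmt-1672) the
Lei–Zhang criterion in tree vocabulary + (ContactInflowPropagatesModulus, support, provable now) the
first-touching comparison lemma + (NoAxialBreakthrough, crux) an admissible log-modulus whose
CONTACT SET near the axis carries only sub-threshold inflow. This composition X ⇐ AxisCriterion ∧
NoAxialBreakthrough ∧ ContactInflowPropagatesModulus is PROVED in the planner's Sketch.lean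
(noBlowupAxisym_of; only real arithmetic: log-monotonicity turns A/ln²(l/r) on {r<δ} into
A·(ln(2δ/r))⁻² on {r ≤ δ/2}).

## Ranked cruxes (4) and support (2)
 #2 AxisCriterion [crux, SHARED stmt-1672]: Lei–Zhang/Wei axis criterion for classical Leray–Hopf
solutions with axisymmetric slices — a published theorem NOT in the tree, ranked first by the
plancard rule because the Assembly rests on it (vendor as a Literature fact or formalise; serves
TokamakQuasistatics too).
 #3 NoAxialBreakthrough [crux, the a-priori heart]: ∃ l δ A admissible (δe³ ≤ l, |Γ₀| ≤ m on {r ≤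
δ}, sup|Γ| < m(δ)) such that at every (t,x) with 0<r<δ and |Γ(t,x)| ≥ A/ln²(l/r) one has x₀u₀ + x₁u₁
> −(2 − 3/ln(l/r))ν. Equivalent in truth value to X given #2 and the comparison lemma, but it NAMES
the measurable obstruction: a blow-up must realise inflow Reynolds number ≥ 2 − 3/L exactly where
the swirl touches the log profile, outside every local Burgers radius r_B = 2(ν/|∂_z
u_z(0,z,t)|)^{1/2}.
 #4 OneSidedRadialCriterion [crux, independent theorem-sized target]: r u_r ≥ −Cν on {r<δ}×[0,T) for
SOME C (any size) ⇒ extension past T — the one-sided, u_r-only analogue of KNSS2009 Thm 5.3 /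
ChenStrainTsaiYau2009 (|u| ≤ C/r, any C) and the scale-critical, sign-reversed complement of
Kubica2015 / KubicaPokornyZajaczkowski2011 (weighted Serrin on u_r⁺) and of Pan's two-sided r|u_r| ≤
Cr^α (LiPan2019 p.3). For C < 2 it is #3's mechanism (proved modulo #2); for C ≥ 2 comparison fails
and KNSS's cut-off argument closes one-sidedly only for C < 2 (planner computation: the −(2/r)∂_rΓ
term integrates to 4π∫Γφ_r, the inflow term to ≤ 2πC·same) — the open gap is exactly C ≥ 2.
 #5 InflowReynoldsBound [crux, necessary condition]: a-priori, ∃ C δ: on {r<δ, |Γ| ≥ ν} (local swirl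
Reynolds number ≥ 1) r u_r ≥ −Cν. Implied by X; its negation is the precise blow-up signature this
line predicts (an inflow jet of unbounded Reynolds number carrying O(ν) swirl onto the axis —
Hou2022PotentiallySingularNS's geometry); with #4 it leaves only the low-swirl set.
 Support: ContactInflowPropagatesModulus (comparison lemma; weak maximum principle for the bounded
subsolution |Γ| − m on {r₀<r<δ}×[0,T'] with bounded drift, Γ = O(r) near the axis on sub-slabs,
strict lateral bound at r = δ); NoBlowupAxisymToWall (X → AX, SHARED stmt-1139). Assembly:
AxisCriterion → NoAxialBreakthrough → ContactInflowPropagatesModulus → NoBlowupAxisymToWall → AX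
(formal; proved in Sketch.lean).

Rationale: WHY THIS LINE. In the axisymmetric class NS is critical, not supercritical (LeiZhang2017 §1): Γ = r
u_θ is dimensionless, obeys a maximum principle, vanishes on the axis, and every published
regularity criterion at the axis is a MODULUS OF CONTINUITY of Γ at r = 0 (ChenFangZhang2017 r^α;
LeiZhang2017 Cor 1.3 |ln r|⁻², any constant; Wei2016 Cor 1.1 |ln r|^{-3/2}). The card transplants
the tool that beat the last logarithm in critical SQG — propagation of a modulus by a
two-point/first-touching maximum principle (KiselevNazarovVolberg2006; ConstantinVicol2012 nonlinear
maximum principle) — onto the one scalar of 3-D NS that has an honest maximum principle, with the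
explicit dictionary θ ↦ Γ, critical scaling ↦ Γ dimensionless, 'modulus at two points' ↦ 'modulus
anchored at the axis where Γ = 0' (so the first step is a ONE-point comparison with the radial
supersolution m(r) = A/ln²(l/r)). Its first output is new, elementary and quantitative: m is a
supersolution iff r u_r ≥ −(2 − 3/ln(l/r))ν, so ONLY INFLOW OF LOCAL REYNOLDS NUMBER ≥ 2 CAN BREAK
THE LOG-MODULUS, and since r u_r = −(r²/2)∂_z u_z(0,z) + O(r⁴) the touching point sits outside every
viscous (Burgers) core. This converts 'axisymmetric blow-up' into 'an inflow jet with r|u_r| ≥ 2ν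
must deliver swirl of size m(r*) to ever smaller radii r*' — the ballerina/tea-leaf mechanism with
constants — and it is the measurable test Hou's interior scenario (Hou2022PotentiallySingularNS,
arXiv:2405.10916) must pass. Imported: parabolic comparison / moduli of continuity (analysis of
active scalars); nothing probabilistic or spectral (no handle on the ∀-datum gap).
PLANNER COMPUTATIONS KEPT IN NOTES: (i) m = A L^{-a}: r m''/m' = (a+1)/L − 1, threshold 2 − (a+1)/L;
power r^α: 2 − α; bare u_θ: 1. (ii) KNSS2009 Thm 5.3's cut-off identity closes ONE-SIDEDLY iff C < 2
(same threshold; KNSS reach any C only through near-constancy + incompressibility, which needs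
two-sided local drift bounds). (iii) Quantitative Lei–Zhang bootstrap (touching needs
(ν/‖∇u‖_∞)^{1/2} ≤ r* ≤ l·exp(−√(A/κν)), κ = ‖Γ₀‖_∞/ν) FAILS with the printed constants: the FBC
cut-off δ = exp(−4C₁/√δ_*) makes ‖∇u‖ bounds exponential in A ≫ exp(2√(A/κν)); the non-perturbative
window is ln(l/r) ∈ [√(A/κν), ~(A/ν)^{2/3}] where the admissible swirl is between ~ν(ν/A)^{1/3} and
κν. That window — swirl Reynolds O(1)…κ at the touching radius — is the honest open core (crux #3);
small κ is LeiZhang2017 Thm 1.4 / Wei2016 Thm 1.1.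
RANKED CRUXES (4; informal + Lean in the items). #2 AxisCriterion (shared stmt-1672; published, not
in tree; first by the plancard rule). #3 NoAxialBreakthrough (a-priori inflow law on the contact
set; the heart; intended proof = the card's COUPLED-MODULI programme: a second, Morrey-type profile
for Ω = ω_θ/r in its 5-D drift–diffusion equation forced by ∂_z(Γ²)/r⁴, closed through r u_r =
−r²∂_zΔ₅⁻¹Ω; NOT filed as an item until #3 moves — depth by glued split). #4 OneSidedRadialCriterion
(one-sided KNSS with any constant; new theorem-sized target; C<2 is #3's mechanism, C ≥ 2 open). #5
InflowReynoldsBound (necessary condition, a-priori one-sided critical bound on the swirl-carrying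
set; its failure is the predicted blow-up signature).
KILL CRITERIA. (a) A rigorous axisymmetric Type-II blow-up (X5a_axi, stmt-0727) refutes X, #3, #5
and AX at once. (b) Cheap: on Hou's published near-axis profiles (arXiv:2107.06509 §3–4,
arXiv:2405.10916) evaluate r u_r/ν and Γ ln²(l/r) at the contact radius: inflow Reynolds ≫ 2 with
Γ|ln r|² growing while resolved ⇒ #3 is dead IN THIS FORM for that datum class (file ¬#3 restricted;
the inflow law survives as the quantitative constraint). (c) A smooth (even infinite-energy, e.g.
forced or exterior) axisymmetric flow with r u_r ≥ −Cν near the axis that blows up kills #4; a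
counterexample to #5 inside the energy class is ¬X. (d) If Wang2013 (JDE 254, 'The role of sign',
paywalled, acq-02070) already proves a one-sided u_r criterion, #4 is re-filed as a Literature fact
and the novelty claim for the C<2 lemma is withdrawn.
DELIBERATELY NOT DECOMPOSED. No children under #3 (coupled Γ/Ω moduli; energy log-measure ∫∫_{|Γ|≥G}
dr dz/r ≤ E₀/(2πG²); local-in-z contact analysis) until #2 lands or #5 moves; no
Liouville/ancient-solution rephrasing (AX-L, AxisymmetricLiouvilleBoundedSwirl) — the zoom-in turns
'near the axis' into 'far field', a different route; no general-3-D analogue (no scalar with a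
maximum principle exists off the symmetry class — stated limitation).
PRIOR DECLS REUSED (support only): swirl, cylRadius, IsAxisymmetric, swirl_transport_holds (PROVED),
IsClassicalNSSolutionOn/IsLerayHopfOn/HasSmoothExtensionPast, AxisymmetricSwirlRegularity; KNSS
swirl-pair vocabulary (KNSSSwirlTransport.lean) as the template for the comparison lemma; shared
items stmt-1134 (X), stmt-1139 (X → AX), stmt-1672 (AxisCriterion). docs/m5/inspiration NOT read
(plancard mode).

Novelty: Nearest prior art = [axis moduli of Γ as TARGET criteria: LeiZhang2017 = arXiv:1505.02628 Cor 1.3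
(|ln r|⁻², any C; read incl. proof pp.6–9), Wei2016 = arXiv:1508.03318 Cor 1.1 (|ln r|^{-3/2}),
ChenFangZhang2017 (r^α)] × [modulus propagation as TOOL: KiselevNazarovVolberg2006,
ConstantinVicol2012]; nobody found pointing the second at the first. Nearest u_r criteria:
KubicaPokornyZajaczkowski2011 = arXiv:1206.4567 Thm 1 and Kubica2015 penalise the POSITIVE part u_r⁺
(outflow, weighted Serrin, energy method); Pan (reported LiPan2019 = arXiv:1805.10752 p.3) needs
two-sided r|u_r| ≤ Cr^α; KNSS2009 Thm 5.3 / ChenStrainTsaiYau2009 need two-sided |u| ≤ C/r. DELTA: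
(i) breakthrough law r u_r ≤ −(2 − 3/ln(l/r))ν at a contact point of the log-modulus (one-sided,
fixed constant, outflow harmless) + Burgers-radius reading; (ii) one-sided INFLOW criterion with any
C (#4; C<2 by comparison, C ≥ 2 open — KNSS cut-off saturates at 2); (iii) a-priori
contact-set/inflow-Reynolds statements #3/#5 isolating the swirl-penetration annulus; (iv) negative
planner computation: quantitative Lei–Zhang bootstrap fails with printed constants (window ln(l/r) ∈
[√(A/κν),(A/ν)^{2/3}]). UNREAD candidate prior art: Wang2013 (JDE 254 'The role of sign', paywalled,
acq-02070) — flagged for the refuter. Card graded new-combination (refuter audit 2026-08-15T06:11Z);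
the route claims no more. Siblings distinct: SwirlSignGeometry (sign of η-source),
TokamakQuasistatics (steady-Euler data; shares AxisCriterion only)  [refs: 1505.02628, 1508.03318, 1206.4567, 1805.10752, LeiZhang2017, Wei2016, ChenFangZhang2017, KiselevNazarovVolberg2006, ConstantinVicol2012, KubicaPokornyZajaczkowski2011, Kubica2015, LiPan2019, KNSS2009, ChenStrainTsaiYau2009, Wang2013]

Barriers (technique_class: two-point-maximum-principle one-sided-inflow-threshold): technique_class: two-point-maximum-principle one-sided-inflow-threshold
- Literature.Barriers.NavierStokesRegularity.TaoAveragedBlowup: not engaged — every item uses the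
transport identity for Γ = r u_θ (in-tree swirl_transport_holds), its maximum principle and the
POINTWISE structure drift + diffusion at a contact point; none of this survives Tao's averaging of
the bilinear form (Tao2016AveragedNS §1.2), so the line is outside the barrier's technique class by
construction.
- Literature.Barriers.NavierStokesRegularity.EnergySupercriticality: applies to cruxes #3 and #5
(they are critical a-priori bounds) and is NOT evaded by size; the bet is structure absent from
Tao's ingredient list: Γ is dimensionless and coercive on u_θ, the inflow law is scale-invariant (r
u_r/ν vs Γ/ν), and the residual gap is logarithmic (LeiZhang2017: 'the gap from regularity is
logarithmic in nature'), exactly the regime where UkhovskiiYudovich/KNSS Thms 5.2–5.3/CSTY/Lei–Zhang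
already beat scaling in this class. Nothing is claimed for general 3-D data (no maximum-principle
scalar exists there) — a stated limitation, not an evasion.
- Literature.Barriers.NavierStokesRegularity.AxisymmetricTypeIExclusion: consistent and
complementary — Type I is already excluded in the class; the comparison/inflow-law argument never
assumes a rate, so it addresses the remaining Type II case; crux #5's negation (unbounded inflow
Reynolds on the swirl set) is a Type-II signature compatible with the barrier.
- Literature.

History (route lifecycle, newest last):
- 2026-08-15T13:49:08Z · CLOSED retired — not-a-thesis: assembly does not conclude the sub-problem Statement (operator:999:1257524)

sub-problem: NavierStokesRegularity · status: closed(retired) · opened planner-plancard-NavierStokesRegularity-Navie-651566d1-0 2026-08-15T11:09:17Z · rev 1 · ledger route-NavierStokesRegularity-KnvAxisInflow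
GENERATED by the gate from the ledger (D-0016/17). Provers cite these decls: `theorem foo : Summit.NavierStokesRegularity.NavierStokesRegularity.Theses.KnvAxisInflow.<Decl> := …` in Summits/NavierStokesRegularity/NavierStokesRegularity/Theorems/<Name>.lean.
-/

namespace Summit.NavierStokesRegularity.NavierStokesRegularity.Theses.KnvAxisInflow

open scoped BigOperators Topology Manifold Classical MeasureTheory ProbabilityTheory Matrix InnerProductSpace ComplexConjugate ContinuousMap
open Filter Set Function TopologicalSpace MeasureTheory

attribute [summit_statement] _root_.NavierStokesRegularity

open Literature.NS

/-- item stmt-NavierStokesRegularity-1134 · target · rank 0 · closed · moot by None · by planner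
why it might fail: It is the whole axisymmetric-with-swirl regularity problem in continuation form: only Type I is excluded (KNSS 2009, Seregin–Šverák 2009); a rigorous Type II axisymmetric singularity (Hou arXiv:2107.06509 focusing-jet scenario; X5a_axi, stmt-0727 of route CertifiedBlowup) refutes it outright.
sources: KochNadirashviliSereginSverak2009, SereginSverak2009, Hou2022PotentiallySingularNS, LeiZhang2017
[target] X = NoBlowupAxisym: every classical solution of unforced NS on ℝ³×[0,T) that is Leray–Hopf
on [0,T), bounded on sub-slabs [0,T']×ℝ³, with axisymmetric slices and rapidly decaying datum
extends classically past T. Standing hypotheses = AxisymmetricTypeIHyp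
(AxisymmetricTypeIBounded.lean) minus its Type I field, plus HasRapidSpatialDecay (u 0). Follows
from B + K (Assembly); implies the rungs L and OS. Dedup note: this is the axisymmetric restriction
of NoBlowup (stmt-NavierStokesRegularity-0054) with the KNSS Thm 6.2 setting's sub-slab boundedness
added. -/
@[route_item "route-NavierStokesRegularity-KnvAxisInflow"]
def NoBlowupAxisym : Prop :=
  ∀ (ν T : ℝ), 0 < ν → 0 < T → ∀ (u : ℝ → EuclideanSpace ℝ (Fin 3) → EuclideanSpace ℝ (Fin 3)) (p : ℝ → EuclideanSpace ℝ (Fin 3) → ℝ), Literature.Analysis.FluidPDE.IsClassicalNSSolutionOn (Set.Ico 0 T) ν 0 u p → Literature.Analysis.FluidPDE.IsLerayHopfOn T ν 0 (u 0) u → (∀ T' < T, ∃ M : ℝ, ∀ t ∈ Set.Icc 0 T', ∀ x, ‖u t x‖ ≤ M) → (∀ t ∈ Set.Ico 0 T, Literature.Analysis.FluidPDE.IsAxisymmetric (u t)) → Literature.Analysis.FluidPDE.HasRapidSpatialDecay (u 0) → Literature.Analysis.FluidPDE.HasSmoothExtensionPast ν 0 u T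

/-- item stmt-NavierStokesRegularity-2897 · crux · rank 3 · closed · moot by None · by planner
why it might fail: Truth-equivalent to no-blow-up (given AxisCriterion+comparison): Hou's focusing jet (arXiv:2107.06509) carries O(‖Γ₀‖∞) swirl to the axis with inflow Reynolds r|u_r|/ν ≫ 2 where Γ touches m; for κ=‖Γ₀‖∞/ν large the window ln(l/r)∈[√(A/κν),(A/ν)^{2/3}] escapes known closures (LeiZhang2017 Thm 1.4).
sources: Hou2022PotentiallySingularNS, arXiv:2405.10916, LeiZhang2017, Wei2016, KiselevNazarovVolberg2006, ConstantinVicol2012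
[crux] NO AXIAL BREAKTHROUGH — the a-priori heart of the card (its INFLOW-BUDGET and COUPLED-MODULI
merged into one sharp contact-set statement). For the standing class (classical NS on [0,T),
Leray–Hopf, bounded on sub-slabs, axisymmetric slices, rapidly decaying datum) there is an
ADMISSIBLE log-modulus m(r) = A/ln²(l/r) — admissible meaning δ·e³ ≤ l (so ln(l/r) ≥ 3 on {r<δ} and
m is increasing and concave there), A ≥ 0, |Γ₀| ≤ m on {r ≤ δ} (free for A large: Γ₀ = O(r²)), and
the strict lateral bound sup_{t,x}|Γ(t,x)| < m(δ) = A/ln²(l/δ) (free for A > ‖Γ₀‖_∞ ln²(l/δ) by the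
swirl maximum principle) — whose CONTACT SET carries only sub-threshold inflow: at every (t,x) with
0 < r < δ and |Γ(t,x)| ≥ A/ln²(l/r) the radial momentum x₀u₀ + x₁u₁ = r u_r exceeds −(2 −
3/ln(l/r))ν. With the support lemma ContactInflowPropagatesModulus this gives |Γ| ≤ m on
{r<δ}×[0,T), and AxisCriterion gives extension past T (chain proved in Sketch.lean). WHY THIS FORM:
planner computation r m''/m' = 3/L − 1 ⇒ m is a supersolution of ∂_tΓ + b·∇Γ = ν(Δ − (2/r)∂_r)Γ
exactly where r u_r ≥ −(2 − 3/L)ν; since r u_r = −(r²/2)∂_z u_z(0,z,t) + O(r⁴), contact can only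
occur outside the local Burgers radius r_B = -/
@[route_item "route-NavierStokesRegularity-KnvAxisInflow"]
def NoAxialBreakthrough : Prop :=
  ∀ (ν T : ℝ), 0 < ν → 0 < T → ∀ (u : ℝ → EuclideanSpace ℝ (Fin 3) → EuclideanSpace ℝ (Fin 3)) (p : ℝ → EuclideanSpace ℝ (Fin 3) → ℝ), Literature.Analysis.FluidPDE.IsClassicalNSSolutionOn (Set.Ico 0 T) ν 0 u p → Literature.Analysis.FluidPDE.IsLerayHopfOn T ν 0 (u 0) u → (∀ T' < T, ∃ M : ℝ, ∀ t ∈ Set.Icc 0 T', ∀ x, ‖u t x‖ ≤ M) → (∀ t ∈ Set.Ico 0 T, Literature.Analysis.FluidPDE.IsAxisymmetric (u t)) → Literature.Analysis.FluidPDE.HasRapidSpatialDecay (u 0) → ∃ l δ A : ℝ, 0 < δ ∧ δ * Real.exp 3 ≤ l ∧ 0 ≤ A ∧ (∀ x, Literature.Analysis.FluidPDE.cylRadius x ≤ δ → |Literature.Analysis.FluidPDE.swirl (u 0) x| ≤ A / Real.log (l / Literature.Analysis.FluidPDE.cylRadius x) ^ 2) ∧ (∀ t ∈ Set.Ico 0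 T, ∀ x, |Literature.Analysis.FluidPDE.swirl (u t) x| < A / Real.log (l / δ) ^ 2) ∧ (∀ t ∈ Set.Ico 0 T, ∀ x, 0 < Literature.Analysis.FluidPDE.cylRadius x → Literature.Analysis.FluidPDE.cylRadius x < δ → A / Real.log (l / Literature.Analysis.FluidPDE.cylRadius x) ^ 2 ≤ |Literature.Analysis.FluidPDE.swirl (u t) x| → -((2 - 3 / Real.log (l / Literature.Analysis.FluidPDE.cylRadius x)) * ν) < x 0 * u t x 0 + x 1 * u t x 1)

/-- item stmt-NavierStokesRegularity-2898 · crux · rank 4 · closed · moot by None · by planner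
why it might fail: C ≥ 2 is open: no radial modulus is a supersolution there (thresholds log 2−3/L, r^α 2−α, u_θ 1), KNSS's cut-off closes one-sidedly only for C<2, any-C results (KNSS Thm 5.3, CSTY2009) need TWO-sided |u|≤C/r, printed signed criteria bound u_r⁺ not inflow (KPZ2011 Thm 1, Kubica2015); Wang2013 unread.
sources: KochNadirashviliSereginSverak2009, KNSS2009, ChenStrainTsaiYau2009, KubicaPokornyZajaczkowski2011, arXiv:1206.4567, Kubica2015
[crux] ONE-SIDED RADIAL (INFLOW) CRITERION WITH ARBITRARY CONSTANT: for the standing class, if for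
some C and δ > 0 the radial momentum satisfies x₀u₀ + x₁u₁ = r u_r ≥ −Cν on {cylRadius < δ} × [0,T)
(inflow toward the axis at most C-times critical; OUTFLOW AND AXIAL VELOCITY UNRESTRICTED), then the
solution extends past T. Positioning (all read 2026-08-15): KNSS2009 Thm 5.3 / Thms 6.1–6.2 and
ChenStrainTsaiYau2009 need the two-sided |u| ≤ C/r (any C); Pan's criterion (reported in LiPan2019
p.3) needs two-sided r|u_r| ≤ Cr^α with decay α > 0 — implied by ours; the published SIGNED criteria
penalise the POSITIVE part u_r⁺ in weighted Serrin norms (KubicaPokornyZajaczkowski2011 =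
arXiv:1206.4567 Thm 1, Kubica2015), i.e. outflow, by energy methods on ω_r/r, ω_θ/r — ours penalises
inflow, by comparison for Γ; both can be true. STATUS BY CONSTANT: C < 2 is this route's mechanism
(for C ≤ 2 − ε take the power modulus B r^ε or the log-modulus; proved modulo
AxisCriterion/ChenFangZhang2017 by ContactInflowPropagatesModulus-type comparison — provers may land
the C < 2 case first as a --supports lemma); C ≥ 2 is OPEN and is the real content: planner's
computation on KNSS's cut-off identity (− -/
@[route_item "route-NavierStokesRegularity-KnvAxisInflow"]
def OneSidedRadialCriterion : Prop :=
  ∀ (ν T : ℝ), 0 < ν → 0 < T → ∀ (u : ℝ → EuclideanSpace ℝ (Fin 3) → EuclideanSpace ℝ (Fin 3)) (p : ℝ → EuclideanSpace ℝ (Fin 3) → ℝ), Literature.Analysis.FluidPDE.IsClassicalNSSolutionOn (Set.Ico 0 T) ν 0 u p → Literature.Analysis.FluidPDE.IsLerayHopfOn T ν 0 (u 0) u → (∀ T' < T, ∃ M : ℝ, ∀ t ∈ Set.Icc 0 T', ∀ x, ‖u t x‖ ≤ M) → (∀ t ∈ Set.Ico 0 T, Literature.Analysis.FluidPDE.IsAxisymmetric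 (u t)) → Literature.Analysis.FluidPDE.HasRapidSpatialDecay (u 0) → (∃ C δ : ℝ, 0 < δ ∧ ∀ t ∈ Set.Ico 0 T, ∀ x, Literature.Analysis.FluidPDE.cylRadius x < δ → -(C * ν) ≤ x 0 * u t x 0 + x 1 * u t x 1) → Literature.Analysis.FluidPDE.HasSmoothExtensionPast ν 0 u T

/-- item stmt-NavierStokesRegularity-2899 · crux · rank 5 · closed · moot by None · by planner
why it might fail: Scale-critical a-priori bound: EnergySupercriticality applies, unevaded by size; only Type I is excluded (KNSS 2009, Seregin–Šverák 2009) and a Type-II focusing swirling jet (Hou arXiv:2107.06509: u_r ≪ 0 near the axis below the ring of maximal u_θ) would make r|u_r|/ν unbounded on {|Γ| ≥ ν} as t↑T.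
sources: Hou2022PotentiallySingularNS, arXiv:2405.10916, KochNadirashviliSereginSverak2009, SereginSverak2009, LeiZhang2017, Tao2016AveragedNS
[crux] A-PRIORI INFLOW REYNOLDS BOUND ON THE SWIRL-CARRYING SET (necessary condition; the card's
INFLOW-BUDGET in its weakest honest form): for the standing class there are C and δ > 0 such that at
every (t,x) with cylRadius x < δ and |Γ(t,x)| ≥ ν (local swirl Reynolds number ≥ 1) one has x₀u₀ +
x₁u₁ = r u_r ≥ −Cν. Scale-invariant on both sides (r u_r/ν vs Γ/ν). Implied by X (near the axis of a
regular solution |Γ| ≥ ν is empty, elsewhere u is bounded); NOT known to imply X (with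
OneSidedRadialCriterion it leaves the low-swirl set {|Γ| < ν}, where only data-dependent smallness
|Γ| ≲ |ln r|^{-3/2} is known to suffice, Wei2016 Thm 1.1). Its NEGATION is the precise blow-up
signature this line predicts and the cheapest thing to measure on Hou's profiles: an inflow jet of
unbounded local Reynolds number carrying O(ν) swirl onto the axis. Tools foreseen: the swirl maximum
principle, the energy log-measure bound ∫∫_{|Γ|≥G} dr dz/r ≤ E₀/(2πG²), local smoothing (KNSS §4
regularity, in tree) on parabolic cylinders of the viscous length l_b = (ν/‖∇b‖_∞)^{1/2}, and the
kinematics u_r/r = ∂_zΔ₅⁻¹(ω_θ/r). -/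
@[route_item "route-NavierStokesRegularity-KnvAxisInflow"]
def InflowReynoldsBound : Prop :=
  ∀ (ν T : ℝ), 0 < ν → 0 < T → ∀ (u : ℝ → EuclideanSpace ℝ (Fin 3) → EuclideanSpace ℝ (Fin 3)) (p : ℝ → EuclideanSpace ℝ (Fin 3) → ℝ), Literature.Analysis.FluidPDE.IsClassicalNSSolutionOn (Set.Ico 0 T) ν 0 u p → Literature.Analysis.FluidPDE.IsLerayHopfOn T ν 0 (u 0) u → (∀ T' < T, ∃ M : ℝ, ∀ t ∈ Set.Icc 0 T', ∀ x, ‖u t x‖ ≤ M) → (∀ t ∈ Set.Ico 0 T, Literature.Analysis.FluidPDE.IsAxisymmetric (u t)) → Literature.Analysis.FluidPDE.HasRapidSpatialDecay (u 0) → ∃ C δ : ℝ, 0 < δ ∧ ∀ t ∈ Set.Ico 0 T, ∀ x, Literature.Analysis.FluidPDE.cylRadius x < δ → ν ≤ |Literature.Analysis.FluidPDE.swirl (u t) x| → -(C * ν) ≤ x 0 * u t x 0 + x 1 * u t x 1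

/-- item stmt-NavierStokesRegularity-1672 · support · rank 2 · closed · moot by None · by planner
why it might fail: Transcription only: the ν/length normalisation (NS rescaling x↦r₁x to δ₀=1/4, t↦t/ν) and the identification with the printed strong solution are exactly what the in-tree ν=1 rendering of the fact already fixes.
sources: LeiZhang2017, arXiv:1505.02628, Wei2016, arXiv:1508.03318, Literature.Analysis.FluidPDE.LeiZhang2017_logModulus_regularity, Literature.Analysis.FluidPDE.Wei2016_logModulus_regularity
[crux] THE LEI–ZHANG / WEI AXIS CRITERION in tree vocabulary (LeiZhang2017 = arXiv:1505.02628 Cor.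
1.3: if sup_{0≤t<T}|Γ(t,r,z)| ≤ C₁|ln r|^{-2} for r ≤ δ₀ ∈ (0,1/2), ANY C₁ > 1 independent of the
data, the axisymmetric strong solution is regular globally; Wei2016 = arXiv:1508.03318 Cor. 1.1:
exponent 3/2 with constant 1). Stated for classical NS solutions on [0,T) that are Leray–Hopf from a
rapidly decaying datum with axisymmetric time slices: ∃ C, r₁>0 with |Γ(t,x)| ≤ C (log(r₁/r))^{-2}
for 0 < r = cylRadius x ≤ r₁/4 and all t ∈ [0,T) ⇒ HasSmoothExtensionPast ν 0 u T (Γ = swirl = x₀u₁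
− x₁u₀ = r u_θ, in-tree). The scaling u ↦ r₁u(r₁²t, r₁x) and t ↦ t/ν reduce it to the printed form
with δ₀ = 1/4 (Γ is scale-invariant; C arbitrary absorbs ν). A PUBLISHED THEOREM NOT IN THE TREE,
ranked first by the plancard rule because the Assembly rests on it: vendor
`Literature.Analysis.FluidPDE.lei_zhang_axis_criterion : Prop` (cite LeiZhang2017 Cor 1.3) and ask
the grounder to re-sign this item as fact → statement, or formalise (weighted energy estimates for J
= −∂_z u_θ/r, Ω = ω_θ/r; ~15 pp). -/
@[route_item "route-NavierStokesRegularity-KnvAxisInflow"]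
def AxisCriterion : Prop :=
  ∀ (ν T : ℝ), 0 < ν → 0 < T → ∀ (u : ℝ → EuclideanSpace ℝ (Fin 3) → EuclideanSpace ℝ (Fin 3)) (p : ℝ → EuclideanSpace ℝ (Fin 3) → ℝ), Literature.Analysis.FluidPDE.IsClassicalNSSolutionOn (Set.Ico 0 T) ν 0 u p → Literature.Analysis.FluidPDE.IsLerayHopfOn T ν 0 (u 0) u → Literature.Analysis.FluidPDE.HasRapidSpatialDecay (u 0) → (∀ t ∈ Set.Ico 0 T, Literature.Analysis.FluidPDE.IsAxisymmetric (u t)) → (∃ C r₁ : ℝ, 0 < r₁ ∧ ∀ t ∈ Set.Ico 0 T, ∀ x, 0 < Literature.Analysis.FluidPDE.cylRadius x → Literature.Analysis.FluidPDE.cylRadius x ≤ r₁ / 4 → |Literature.Analysis.FluidPDE.swirl (u t) x| ≤ C * (Real.log (r₁ / Literature.Analysis.FluidPDE.cylRadius x))⁻¹ ^ 2) → Literature.Analysis.FluidPDE.HasSmoothExtensionPast ν 0 u T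

/-- item stmt-NavierStokesRegularity-1139 · support · rank 9 · closed · moot by None · by planner
sources: Fefferman2000, KochNadirashviliSereginSverak2009, RobinsonRodrigoSadowski2016
[support] Glue X → AX (axisymmetric twin of stmt-NavierStokesRegularity-0055; read its
grounder/refuter notes first): for a smooth divergence-free rapidly decaying axisymmetric datum take
the local classical Leray–Hopf solution (fact Literature.NS.local_classical_existence_schwartz /
local_classical_lerayHopf as ruled for 0055), which is bounded on compact sub-slabs and stays
axisymmetric (rotation covariance IsClassicalNSSolutionOn.conj_linearIsometryEquiv +
weak_strong_uniqueness, or isAxisymmetric_of_data_holds); at its maximal time T* apply X to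
contradict maximality; glue to a global classical solution on Ici 0; bounded energy from the energy
inequality; conclude the three conjuncts of AxisymmetricSwirlRegularity. Takes the same named
local-theory facts as hypotheses if the grounder so rules. -/
@[route_item "route-NavierStokesRegularity-KnvAxisInflow"]
def NoBlowupAxisymToWall : Prop :=
  (∀ (ν T : ℝ), 0 < ν → 0 < T → ∀ (u : ℝ → EuclideanSpace ℝ (Fin 3) → EuclideanSpace ℝ (Fin 3)) (p : ℝ → EuclideanSpace ℝ (Fin 3) → ℝ), Literature.Analysis.FluidPDE.IsClassicalNSSolutionOn (Set.Ico 0 T) ν 0 u p → Literature.Analysis.FluidPDE.IsLerayHopfOn T ν 0 (u 0) u → (∀ T' < T, ∃ M : ℝ, ∀ t ∈ Set.Icc 0 T', ∀ x, ‖u t x‖ ≤ M) → (∀ t ∈ Set.Ico 0 T, Literature.Analysis.FluidPDE.IsAxisymmetric (u t)) → Literature.Analysis.FluidPDE.HasRapidSpatialDecay (u 0) → Literature.Analysis.FluidPDE.HasSmoothExtensionPast ν 0 u T) → Literature.Analysis.FluidPDE.AxisymmetricSwirlRegularity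

/-- item stmt-NavierStokesRegularity-2900 · support · rank 9 · closed · moot by None · by planner
why it might fail: Bookkeeping only: weak maximum principle for the bounded subsolution |Γ| − m on the unbounded slab {r₀<r<δ}×[0,T'] (bounded drift by the sub-slab bound, barrier ε·cosh(ηz)e^{λt}); near the axis |Γ| ≤ M r < m for r < r₀(M,A,l); A = 0 makes the lateral hypothesis false (vacuous).
sources: KNSS2009, KiselevNazarovVolberg2006, ConstantinVicol2012, LeiZhang2017
[support, provable now] CONTACT-SET COMPARISON LEMMA (the card's 'lemma above as a theorem';
first-touching step of the two-point maximum principle, here a one-point comparison because the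
modulus is anchored at the axis where Γ = 0): for the standing class and reals l, δ, A with 0 < δ,
δ·e³ ≤ l, 0 ≤ A: if |Γ₀| ≤ m := A/ln²(l/r) on {r ≤ δ}, if sup_{t<T, x}|Γ(t,x)| < m(δ) strictly, and
if at every (t,x) with 0<r<δ and |Γ(t,x)| ≥ m(r) one has r u_r = x₀u₀ + x₁u₁ > −(2 − 3/ln(l/r))ν,
then |Γ(t,x)| ≤ m(r) for all t ∈ [0,T), r < δ. PROOF SKETCH (planner, checked): Γ = swirl(u t)
solves ∂_tΓ + b·∇Γ = ν(ΔΓ − (2/r)∂_rΓ) off the axis (in-tree swirl_transport_holds; pressure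
axisymmetric for axisymmetric classical solutions, cf. KNSSSwirlLiouville.lean); for m = m(r): L[m]
:= u_r m' − ν(m'' − m'/r) = (m'/r)(r u_r + ν(2 − 3/ln(l/r))) since r m''/m' = 3/ln(l/r) − 1, and m'
> 0; so on the set {|Γ| ≥ m, 0<r<δ} the hypothesis makes m a strict supersolution and w = ±Γ − m a
subsolution wherever w ≥ 0. Work on [0,T'] ⊂ [0,T): u bounded by M there, so |Γ| ≤ M r < m(r) for r
< r₀ (r ln²(l/r) → 0), w < 0 near the axis; at r = δ, w < 0 by the strict lateral bound; w bounded;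
drift b bounded on {r ≥ r₀} -/
@[route_item "route-NavierStokesRegularity-KnvAxisInflow"]
def ContactInflowPropagatesModulus : Prop :=
  ∀ (ν T : ℝ), 0 < ν → 0 < T → ∀ (u : ℝ → EuclideanSpace ℝ (Fin 3) → EuclideanSpace ℝ (Fin 3)) (p : ℝ → EuclideanSpace ℝ (Fin 3) → ℝ), Literature.Analysis.FluidPDE.IsClassicalNSSolutionOn (Set.Ico 0 T) ν 0 u p → Literature.Analysis.FluidPDE.IsLerayHopfOn T ν 0 (u 0) u → (∀ T' < T, ∃ M : ℝ, ∀ t ∈ Set.Icc 0 T', ∀ x, ‖u t x‖ ≤ M) → (∀ t ∈ Set.Ico 0 T, Literature.Analysis.FluidPDE.IsAxisymmetric (u t)) → Literature.Analysis.FluidPDE.HasRapidSpatialDecay (u 0) → ∀ l δ A : ℝ, 0 < δ → δ * Real.exp 3 ≤ l → 0 ≤ A → (∀ x, Literature.Analysis.FluidPDE.cylRadius x ≤ δ → |Literature.Analysis.FluidPDE.swirl (u 0) x| ≤ A / Real.log (l / Literature.Analysis.FluidPDE.cylRadius x) ^ 2) → (∀ t ∈ Set.Ico 0 T, ∀ x,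 |Literature.Analysis.FluidPDE.swirl (u t) x| < A / Real.log (l / δ) ^ 2) → (∀ t ∈ Set.Ico 0 T, ∀ x, 0 < Literature.Analysis.FluidPDE.cylRadius x → Literature.Analysis.FluidPDE.cylRadius x < δ → A / Real.log (l / Literature.Analysis.FluidPDE.cylRadius x) ^ 2 ≤ |Literature.Analysis.FluidPDE.swirl (u t) x| → -((2 - 3 / Real.log (l / Literature.Analysis.FluidPDE.cylRadius x)) * ν) < x 0 * u t x 0 + x 1 * u t x 1) → ∀ t ∈ Set.Ico 0 T, ∀ x, Literature.Analysis.FluidPDE.cylRadius x < δ → |Literature.Analysis.FluidPDE.swirl (u t) x| ≤ A / Real.log (l / Literature.Analysis.FluidPDE.cylRadius x) ^ 2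

/-- item stmt-NavierStokesRegularity-2901 · assembly · rank 1 · closed · moot by None · by planner
sources: LeiZhang2017, Fefferman2000
[assembly] AxisCriterion → NoAxialBreakthrough → ContactInflowPropagatesModulus →
NoBlowupAxisymToWall → Literature.Analysis.FluidPDE.AxisymmetricSwirlRegularity. PROVED in the
planner's Sketch.lean (assembly_holds via noBlowupAxisym_of: NoAxialBreakthrough hands (l,δ,A) and
the contact-set inflow law, the comparison lemma returns |Γ| ≤ A/ln²(l/r) on {r<δ}, which for 0 < r
≤ δ/2 is ≤ A·(ln(2δ/r))⁻² because 2δ ≤ l — Real.log_le_log, div_le_div_of_nonneg_left, inv_pow — so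
AxisCriterion applies with (C, r₁) = (A, 2δ); then the shared glue). TARGET IS THE WALL AX
(intermediate thesis, PROBLEMS.md §3), not NavierStokesRegularity: AX ↛ Clay (A); summit-side use =
proved kill edge certifiedBlowup_kill_edge (stmt-0729): AX → X5b → ¬X5a_axi. The cruxes
OneSidedRadialCriterion and InflowReynoldsBound are rungs (X ⇒ both; oneSided_of_X proved in
Sketch.lean) that carry the card's falsifiable structure and key its staffing. -/
@[route_item "route-NavierStokesRegularity-KnvAxisInflow"]
def Assembly : Prop :=
  AxisCriterion → NoAxialBreakthrough → ContactInflowPropagatesModulus → NoBlowupAxisymToWall → Literature.Analysis.FluidPDE.AxisymmetricSwirlRegularity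

end Summit.NavierStokesRegularity.NavierStokesRegularity.Theses.KnvAxisInflow
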